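import Literature.Analysis.InnerProduct.KahanEigenvaluePairing
import Literature.Analysis.InnerProduct.SubspaceResidualClusterBound
import HarnessLib

/-!
# Indexed enclosure of ALL eigenvalues of a Hermitian interval family from an approximate
# eigendecomposition (soundness of the `syev-indexed` certificate kind; Kahan 1975 + Weyl)

Topic `Literature/Analysis/ValidatedNumerics` (the certificate-soundness layer over the perturbation
theory of `Literature/Analysis/InnerProduct`). The statement a verified-eigenvalue kernel for DENSE
symmetric / Hermitian matrices needs in order to enclose EVERY eigenvalue, with its INDEX, of every
member of an entrywise interval family at once:

* Kahan's theorem [Kahan1975] = Stewart–Sun, *Matrix Perturbation Theory* (1990), proof of Thm IV.5.4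
  (display before (5.9)) [cite: StewartSun1990, Thm IV.5.4]: for a Hermitian centre `C`, ANY square matrix
  `X` with `σ_min(X) ≥ s > 0` (nearly orthonormal computed eigenvectors) and a Hermitian `M` (the
  diagonal matrix of computed eigenvalues) with `‖C X − X M‖₂ ≤ ε`, the descending eigenvalue lists
  pair up: `|λ↓ᵢ(C) − λ↓ᵢ(M)| ≤ ε / s` — in the tree as
  `Literature.Analysis.InnerProduct.abs_eigenvalues₀_sub_eigenvalues₀_le_div`;
* Weyl's perturbation theorem with Schur's test [cite: HornJohnson2013, Cor 4.3.15 and §5.6]: if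
  `‖A i j − C i j‖ ≤ Δ i j` entrywise and every row sum and every column sum of `Δ` is `≤ ρ`, then
  `‖A − C‖₂ ≤ ρ` and `|λ↓ᵢ(A) − λ↓ᵢ(C)| ≤ ρ` for every index.

What is typed here (finite Hermitian matrices over `𝕜 = ℝ` or `ℂ`, Mathlib's descending enumeration
`Matrix.IsHermitian.eigenvalues₀`, norms unbundled as sums of squares so that a certificate's rational
data can discharge the hypotheses literally):

* `abs_eigenvalues₀_sub_eigenvalues₀_le_of_entry_le` — the interval-family Weyl bound (matrix form);
* `abs_eigenvalues₀_sub_eigenvalues₀_le_div_add_of_entry_le` — THE SOUNDNESS STATEMENT of the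
  `syev-indexed` kind (certnum L1, `cap.ila.eig`): residual bound `ε` at the centre, Gram lower bound
  `s²`, family radius `ρ` ⟹ `|λ↓ᵢ(A) − λ↓ᵢ(M)| ≤ ε / s + ρ` for every `i` and every Hermitian member
  `A`. CERTIFICATE FIELDS ↦ binders: `data.k1.r ↦ ε`, `1 − data.k1.eps ↦ s²` (the kernel stores
  `eps ≥ ‖Xᴴ X − 1‖₂`, whence `Σ ‖(X y)ᵢ‖² ≥ (1 − eps) Σ ‖y_j‖²`), `data.k1.varrho ↦ ρ`,
  `data.proposal.d ↦ M = diagonal d`, `data.matrix ↦ C`, `data.family.rad ↦ Δ`.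

Everything is PROVED from the two tree files imported; no definitions, no named facts, standard
axioms. NOT typed here: the per-cluster quadratic refinement (Stewart–Sun Thm V.3.12 for a
NON-orthonormal frame — the tree has the isometric-frame form
`abs_eigenvalues₀_sub_eigenvalues₀_le_sq_div`; the composition with a polar factor is a separate
statement), floating-point rounding (the kernel's arithmetic lineages establish the three bounds;
this file is what they imply), and singular values (Jordan–Wielandt) — see the kernel's design note.

SEARCH RECORD (2026-08-26, `lean search`): `abs_eigenvalues₀_sub` — only the two InnerProduct
theorems above (Kahan; Stewart V.3.12); `eigenvalues₀.*entry`, `of_entry_le` — only the COUNT form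
`card_le_card_abs_eigenvalues_sub_le_of_frame_of_entry_le` (SubspaceResidualClusterBound); matrix
Weyl exists as the additive inequalities `eigenvalues₀_add_le_add` (WeylEigenvalueInequalities) and as
the operator Lipschitz form `abs_eigenvalues_sub_eigenvalues_le` (CourantFischerBounds), used here.
-/

noncomputable section

open scoped InnerProductSpace
open Module Finset Matrix WithLp

namespace Literature.Analysis.ValidatedNumerics

open Literature.Analysis.InnerProduct

variable {𝕜 : Type*} [RCLike 𝕜] {m : Type*} [Fintype m] [DecidableEq m]

/-- **Weyl's bound for an entrywise interval family of Hermitian matrices.** If `A`, `C` are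
Hermitian with `‖A i j − C i j‖ ≤ Δ i j`, and every row sum and every column sum of `Δ` is at most
`ρ ≥ 0` (so `‖A − C‖₂ ≤ ρ` by Schur's test), then `|λ↓ᵢ(A) − λ↓ᵢ(C)| ≤ ρ` for every index `i`
(descending enumerations `Matrix.IsHermitian.eigenvalues₀`). [cite: HornJohnson2013, Cor 4.3.15] -/
theorem abs_eigenvalues₀_sub_eigenvalues₀_le_of_entry_le {A C : Matrix m m 𝕜} (hA : A.IsHermitian)
    (hC : C.IsHermitian) {Δ : Matrix m m ℝ} (hΔ : ∀ i j, ‖A i j - C i j‖ ≤ Δ i j) {ρ : ℝ}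
    (hρ : 0 ≤ ρ) (hrow : ∀ i, ∑ j, Δ i j ≤ ρ) (hcol : ∀ j, ∑ i, Δ i j ≤ ρ)
    (i : Fin (Fintype.card m)) : |hA.eigenvalues₀ i - hC.eigenvalues₀ i| ≤ ρ := by
  have hM : ∀ i j, ‖(A - C) i j‖ ≤ Δ i j := fun i j => by
    rw [Matrix.sub_apply]; exact hΔ i j
  -- Schur's test: `‖(A - C) v‖² ≤ ρ² ‖v‖²`
  have hS : ∀ v : m → 𝕜, ∑ i, ‖((A - C) *ᵥ v) i‖ ^ 2 ≤ ρ * ρ * ∑ j, ‖v j‖ ^ 2 :=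
    fun v => sum_norm_sq_mulVec_le_of_norm_le_of_rowSum_colSum hM hρ hrow hcol v
  -- the form bound `|re ⟪(T_A - T_C) x, x⟫| ≤ ρ ‖x‖²` on `EuclideanSpace 𝕜 m`
  have hform : ∀ x : EuclideanSpace 𝕜 m,
      |RCLike.re ⟪(toEuclideanLin A - toEuclideanLin C) x, x⟫_𝕜| ≤ ρ * ‖x‖ ^ 2 := by
    intro x
    have h1 : (toEuclideanLin A - toEuclideanLin C) x = toLp 2 ((A - C) *ᵥ ofLp x) := by
      rw [← map_sub]; rfl
    have hnorm : ‖(toEuclideanLin A - toEuclideanLin C) x‖ ≤ ρ * ‖x‖ := by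
      refine (pow_le_pow_iff_left₀ (norm_nonneg _) (mul_nonneg hρ (norm_nonneg _))
        two_ne_zero).1 ?_
      rw [h1, EuclideanSpace.norm_sq_eq, mul_pow, EuclideanSpace.norm_sq_eq, sq ρ]
      exact hS (ofLp x)
    calc |RCLike.re ⟪(toEuclideanLin A - toEuclideanLin C) x, x⟫_𝕜|
        ≤ ‖⟪(toEuclideanLin A - toEuclideanLin C) x, x⟫_𝕜‖ := RCLike.abs_re_le_norm _
      _ ≤ ‖(toEuclideanLin A - toEuclideanLin C) x‖ * ‖x‖ := norm_inner_le_norm _ _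
      _ ≤ ρ * ‖x‖ * ‖x‖ := mul_le_mul_of_nonneg_right hnorm (norm_nonneg _)
      _ = ρ * ‖x‖ ^ 2 := by ring
  exact abs_eigenvalues_sub_eigenvalues_le (isSymmetric_toEuclideanLin_iff.mpr hC)
    (isSymmetric_toEuclideanLin_iff.mpr hA) finrank_euclideanSpace hform i

/-- **Soundness of the indexed all-eigenvalue certificate (`syev-indexed`, K1 + family): Kahan's
theorem at the centre plus Weyl for the interval family.** Let `C` (the centre, e.g. a binary64
symmetric matrix read exactly) and `M` (e.g. the diagonal matrix of the computed eigenvalues) be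
Hermitian, `X` ANY square matrix with the Gram lower bound `s² Σ_j ‖y_j‖² ≤ Σᵢ ‖(X y)ᵢ‖²` (`s > 0`),
and `Σᵢ ‖((C X − X M) y)ᵢ‖² ≤ ε² Σ_j ‖y_j‖²` (`ε ≥ 0`). Then for EVERY Hermitian `A` with
`‖A i j − C i j‖ ≤ Δ i j`, `Δ` having all row sums and column sums `≤ ρ` (`ρ ≥ 0`), and every index
`i`: `|λ↓ᵢ(A) − λ↓ᵢ(M)| ≤ ε / s + ρ`. For `M = diagonal d` with `d` sorted this says: the `i`-th
eigenvalue of every member of the family lies in `[dᵢ − ε/s − ρ, dᵢ + ε/s + ρ]` (same order on both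
sides, multiplicity counted). [cite: StewartSun1990, Thm IV.5.4 (proof, display before (5.9))]
[cite: HornJohnson2013, Cor 4.3.15] -/
theorem abs_eigenvalues₀_sub_eigenvalues₀_le_div_add_of_entry_le {A C : Matrix m m 𝕜}
    (hA : A.IsHermitian) (hC : C.IsHermitian) (X : Matrix m m 𝕜) {Mk : Matrix m m 𝕜}
    (hM : Mk.IsHermitian) {s ε ρ : ℝ} (hs : 0 < s) (hε : 0 ≤ ε) (hρ : 0 ≤ ρ)
    (hX : ∀ y : m → 𝕜, s ^ 2 * ∑ j, ‖y j‖ ^ 2 ≤ ∑ i, ‖(X *ᵥ y) i‖ ^ 2)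
    (hres : ∀ y : m → 𝕜, ∑ i, ‖((C * X - X * Mk) *ᵥ y) i‖ ^ 2 ≤ ε ^ 2 * ∑ j, ‖y j‖ ^ 2)
    {Δ : Matrix m m ℝ} (hΔ : ∀ i j, ‖A i j - C i j‖ ≤ Δ i j) (hrow : ∀ i, ∑ j, Δ i j ≤ ρ)
    (hcol : ∀ j, ∑ i, Δ i j ≤ ρ) (i : Fin (Fintype.card m)) :
    |hA.eigenvalues₀ i - hM.eigenvalues₀ i| ≤ ε / s + ρ := by
  have h1 : |hC.eigenvalues₀ i - hM.eigenvalues₀ i| ≤ ε / s :=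
    abs_eigenvalues₀_sub_eigenvalues₀_le_div hC X hM hs hε hX hres i
  have h2 : |hA.eigenvalues₀ i - hC.eigenvalues₀ i| ≤ ρ :=
    abs_eigenvalues₀_sub_eigenvalues₀_le_of_entry_le hA hC hΔ hρ hrow hcol i
  calc |hA.eigenvalues₀ i - hM.eigenvalues₀ i|
      = |(hA.eigenvalues₀ i - hC.eigenvalues₀ i) + (hC.eigenvalues₀ i - hM.eigenvalues₀ i)| := by
        ring_nf
    _ ≤ |hA.eigenvalues₀ i - hC.eigenvalues₀ i| + |hC.eigenvalues₀ i - hM.eigenvalues₀ i| :=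
        abs_add_le _ _
    _ ≤ ρ + ε / s := add_le_add h2 h1
    _ = ε / s + ρ := add_comm _ _

/-- **Interval form read by the certificate's verifier** (same hypotheses, `M` Hermitian with
eigenvalue list `λ↓(M)`): every eigenvalue `λ↓ᵢ(A)` of every member lies in the closed interval
`[λ↓ᵢ(M) − (ε/s + ρ), λ↓ᵢ(M) + (ε/s + ρ)]`. [cite: StewartSun1990, Thm IV.5.4] -/
theorem eigenvalues₀_mem_Icc_of_entry_le {A C : Matrix m m 𝕜}
    (hA : A.IsHermitian) (hC : C.IsHermitian) (X : Matrix m m 𝕜) {Mk : Matrix m m 𝕜}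
    (hM : Mk.IsHermitian) {s ε ρ : ℝ} (hs : 0 < s) (hε : 0 ≤ ε) (hρ : 0 ≤ ρ)
    (hX : ∀ y : m → 𝕜, s ^ 2 * ∑ j, ‖y j‖ ^ 2 ≤ ∑ i, ‖(X *ᵥ y) i‖ ^ 2)
    (hres : ∀ y : m → 𝕜, ∑ i, ‖((C * X - X * Mk) *ᵥ y) i‖ ^ 2 ≤ ε ^ 2 * ∑ j, ‖y j‖ ^ 2)
    {Δ : Matrix m m ℝ} (hΔ : ∀ i j, ‖A i j - C i j‖ ≤ Δ i j) (hrow : ∀ i, ∑ j, Δ i j ≤ ρ)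
    (hcol : ∀ j, ∑ i, Δ i j ≤ ρ) (i : Fin (Fintype.card m)) :
    hA.eigenvalues₀ i ∈ Set.Icc (hM.eigenvalues₀ i - (ε / s + ρ)) (hM.eigenvalues₀ i + (ε / s + ρ)) := by
  have h := abs_eigenvalues₀_sub_eigenvalues₀_le_div_add_of_entry_le hA hC X hM hs hε hρ hX hres
    hΔ hrow hcol i
  rw [abs_le] at h
  exact ⟨by linarith [h.1], by linarith [h.2]⟩

end Literature.Analysis.ValidatedNumerics

end
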